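import Mathlib
import HarnessLib
import Literature.MathematicalPhysics.QuantumLattice.HeisenbergOrderNeelRiemann3
import Summits.HubbardSuperconductivity.HubbardSuperconductivity.Theorems.ChiralWindowCwKLChiralWindowMuWindow

/-!
# Crux `CwKLChiralWindow` (stmt-HubbardSuperconductivity-1741), line `Sketch`: stub `stub_klFillingUpper`

For the nearest-neighbour band `ε₀ = squareDispersion 1 0` (`ε₀ p = -2 (cos p₀ + cos p₁)`) the
filling is `n(μ) = 2 vol({ε₀ < μ} ∩ BZ) / (2π)²` (`kl_mu_filling_eq`).  We prove the coarse upper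
filling inequality `n(-1) ≤ 7/10` (enclosure hypothesis E0, upper end) by disc containment:

* a point `p` of the Fermi sea `{ε₀ < -1} ∩ BZ` has `cos p₀ + cos p₁ > 1/2` and `|pᵢ| ≤ π`, and this
  forces `p₀² + p₁² < (2π/3)²` (`klU_sq_add_sq_lt`);
* hence `vol({ε₀ < -1} ∩ BZ) ≤ vol B(0, 2π/3) = π (2π/3)²` and `n(-1) ≤ 2π/9 < 7/10` (`π < 3.15`).

The planar inequality (sharp at `(2π/3, 0)`): with `a = |p₀| ≥ b = |p₁|` (by symmetry), either
`a ≥ 2π/3` (then `cos a ≤ -1/2`, `cos b ≤ 1`), or `a < 2π/3` and `a² + b² ≥ (2π/3)²` is excluded by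
the two elementary envelopes `cos (2π/3 - e) ≤ -1/2 + e²/4 + (√3/2) e` (`e ≥ 0`; from
`1 - e²/2 ≤ cos e`, `sin e ≤ e`) and `cos b ≤ 1 - b²/2 + b⁴/24` (the tree's
`KLSNumerics.cos_le_taylor_four`), which leave a polynomial inequality in `(e, b)` with room to
spare (`klU_poly`).  Folklore; no definitions.
-/

set_option linter.dupNamespace false

namespace Summit.HubbardSuperconductivity.HubbardSuperconductivity.Theorems

open MeasureTheory Literature.MathematicalPhysics.QuantumLattice

/-! ### An elementary cosine envelope near `2π/3`

(The second envelope, `cos x ≤ 1 - x²/2 + x⁴/24` for `0 ≤ x`, is the tree's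
`KLSNumerics.cos_le_taylor_four`.) -/

/-- Near `2π/3` from below: `cos (2π/3 - e) ≤ -1/2 + e²/4 + 0.8661 e` for `e ≥ 0`
(`cos (2π/3 - e) = -cos e / 2 + (√3/2) sin e`, `1 - e²/2 ≤ cos e`, `sin e ≤ e`, `√3/2 < 0.8661`).
[folklore] -/
theorem klU_cos_le_near {e : ℝ} (he : 0 ≤ e) :
    Real.cos (2 * Real.pi / 3 - e) ≤ -1 / 2 + e ^ 2 / 4 + 8661 / 10000 * e := by
  have h13 : 2 * Real.pi / 3 = Real.pi - Real.pi / 3 := by ring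
  have h1 : Real.cos (2 * Real.pi / 3) = -1 / 2 := by
    rw [h13, Real.cos_pi_sub, Real.cos_pi_div_three]
    norm_num
  have h2 : Real.sin (2 * Real.pi / 3) = Real.sqrt 3 / 2 := by
    rw [h13, Real.sin_pi_sub, Real.sin_pi_div_three]
  have h3 : Real.sqrt 3 ≤ 17322 / 10000 := by
    have := Real.sqrt_le_sqrt (show (3 : ℝ) ≤ (17322 / 10000) ^ 2 by norm_num)
    rwa [Real.sqrt_sq (by norm_num)] at this
  rw [Real.cos_sub, h1, h2]
  have hc := Real.one_sub_sq_div_two_le_cos (x := e)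
  have hs := Real.sin_le he
  have t1 : Real.sqrt 3 / 2 * Real.sin e ≤ Real.sqrt 3 / 2 * e :=
    mul_le_mul_of_nonneg_left hs (by positivity)
  have t2 : Real.sqrt 3 / 2 * e ≤ 8661 / 10000 * e :=
    mul_le_mul_of_nonneg_right (by linarith) he
  linarith

/-! ### The planar inequality -/

/-- The polynomial core: with `R = 2π/3 ∈ (2.0943, 2.0944)`, `1.48 ≤ a ≤ R`, `0 ≤ b ≤ a`,
`R² ≤ a² + b²`, the two envelopes force `cos a + cos b ≤ 1/2`.  Writing `e = R - a ∈ [0, 0.6144]`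
and `m = R² - a² = e (R + a) ≤ b²`: `1 - b²/2 + b⁴/24 ≤ 1 - m/2 + m²/24` (the quartic is decreasing
in `b² ≤ R² < 6`), and `e²/4 + 0.8661 e - m/2 + m²/24 = e (0.8661 - R + 3e/4 + e (R+a)²/24) ≤ 0`.
[folklore] -/
theorem klU_poly {R a b ca cb : ℝ} (hR1 : 2.0943 < R) (hR2 : R < 2.0944) (ha1 : 1.48 ≤ a)
    (haR : a ≤ R) (hb0 : 0 ≤ b) (hba : b ≤ a) (hm : R ^ 2 ≤ a ^ 2 + b ^ 2)
    (hca : ca ≤ -1 / 2 + (R - a) ^ 2 / 4 + 8661 / 10000 * (R - a))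
    (hcb : cb ≤ 1 - b ^ 2 / 2 + b ^ 4 / 24) : ca + cb ≤ 1 / 2 := by
  have he0 : 0 ≤ R - a := by linarith
  have he1 : R - a ≤ 0.6144 := by linarith
  have hbb : b * b ≤ a * a := mul_self_le_mul_self hb0 hba
  have hRR : R * R ≤ 2.0944 * 2.0944 := mul_le_mul hR2.le hR2.le (by linarith) (by norm_num)
  -- the quartic envelope is decreasing in `b²` on the relevant range
  have hd : 0 ≤ b ^ 2 - (R ^ 2 - a ^ 2) := by linarith
  have hs : b ^ 2 + (R ^ 2 - a ^ 2) ≤ 4.39 := by nlinarith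
  have key : 1 - b ^ 2 / 2 + b ^ 4 / 24 ≤
      1 - (R ^ 2 - a ^ 2) / 2 + (R ^ 2 - a ^ 2) ^ 2 / 24 := by
    nlinarith [mul_nonneg hd (show (0 : ℝ) ≤ 1 / 2 - (b ^ 2 + (R ^ 2 - a ^ 2)) / 24 by linarith)]
  -- the remaining one-variable bracket is negative
  have h2R0 : 0 ≤ R + a := by linarith
  have h2R1 : R + a ≤ 4.1888 := by linarith
  have hsq : (R + a) ^ 2 ≤ 17.55 := by
    nlinarith [mul_le_mul h2R1 h2R1 h2R0 (by norm_num : (0 : ℝ) ≤ 4.1888)]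
  have h3 : (R - a) * (R + a) ^ 2 ≤ 0.6144 * 17.55 :=
    mul_le_mul he1 hsq (sq_nonneg _) (by norm_num)
  have hbr : 8661 / 10000 - R + 3 * (R - a) / 4 + (R - a) * (R + a) ^ 2 / 24 ≤ 0 := by
    linarith
  have hid : (-1 / 2 + (R - a) ^ 2 / 4 + 8661 / 10000 * (R - a)) +
      (1 - (R ^ 2 - a ^ 2) / 2 + (R ^ 2 - a ^ 2) ^ 2 / 24) - 1 / 2 =
      (R - a) * (8661 / 10000 - R + 3 * (R - a) / 4 + (R - a) * (R + a) ^ 2 / 24) := by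
    ring
  nlinarith [mul_nonneg he0 (neg_nonneg.mpr hbr)]

/-- Ordered case of the planar inequality: for `0 ≤ b ≤ a ≤ 2π/3` with `(2π/3)² ≤ a² + b²`,
`cos a + cos b ≤ 1/2` (then `a ≥ 1.48`, and `klU_poly` applies to the two envelopes). [folklore] -/
theorem klU_cos_add_cos_le_half {a b : ℝ} (hb0 : 0 ≤ b) (hba : b ≤ a)
    (haR : a ≤ 2 * Real.pi / 3) (hm : (2 * Real.pi / 3) ^ 2 ≤ a ^ 2 + b ^ 2) :
    Real.cos a + Real.cos b ≤ 1 / 2 := by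
  have hR1 : (2.0943 : ℝ) < 2 * Real.pi / 3 := by linarith [Real.pi_gt_d4]
  have hR2 : 2 * Real.pi / 3 < (2.0944 : ℝ) := by linarith [Real.pi_lt_d4]
  have ha0 : 0 ≤ a := hb0.trans hba
  have ha1 : (1.48 : ℝ) ≤ a := by
    by_contra h
    have ha2 : a * a < 1.48 * 1.48 := mul_self_lt_mul_self ha0 (lt_of_not_ge h)
    have hbb : b * b ≤ a * a := mul_self_le_mul_self hb0 hba
    have hRR : (2.0943 : ℝ) * 2.0943 ≤ (2 * Real.pi / 3) * (2 * Real.pi / 3) :=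
      mul_self_le_mul_self (by norm_num) hR1.le
    nlinarith
  have hca : Real.cos a ≤
      -1 / 2 + (2 * Real.pi / 3 - a) ^ 2 / 4 + 8661 / 10000 * (2 * Real.pi / 3 - a) := by
    have h := klU_cos_le_near (e := 2 * Real.pi / 3 - a) (by linarith)
    rwa [sub_sub_cancel] at h
  exact klU_poly hR1 hR2 ha1 haR hb0 hba hm hca (KLSNumerics.cos_le_taylor_four hb0)

/-- Ordered planar inequality: for `0 ≤ b ≤ a ≤ π` with `cos a + cos b > 1/2` one has
`a² + b² < (2π/3)²` (if `a ≥ 2π/3` then `cos a ≤ -1/2` and `cos b ≤ 1`; otherwise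
`klU_cos_add_cos_le_half`). [folklore] -/
theorem klU_sq_add_sq_lt_of_le {a b : ℝ} (hb0 : 0 ≤ b) (hba : b ≤ a) (haπ : a ≤ Real.pi)
    (h : 1 / 2 < Real.cos a + Real.cos b) : a ^ 2 + b ^ 2 < (2 * Real.pi / 3) ^ 2 := by
  rcases lt_or_ge (a ^ 2 + b ^ 2) ((2 * Real.pi / 3) ^ 2) with hlt | hge
  · exact hlt
  exfalso
  rcases le_or_gt a (2 * Real.pi / 3) with haR | haR
  · exact absurd h (not_lt.mpr (klU_cos_add_cos_le_half hb0 hba haR hge))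
  · have hcos : Real.cos a ≤ Real.cos (2 * Real.pi / 3) :=
      Real.cos_le_cos_of_nonneg_of_le_pi (by positivity) haπ haR.le
    have h23 : Real.cos (2 * Real.pi / 3) = -1 / 2 := by
      rw [show 2 * Real.pi / 3 = Real.pi - Real.pi / 3 by ring, Real.cos_pi_sub,
        Real.cos_pi_div_three]
      norm_num
    linarith [Real.cos_le_one b]

/-- The planar inequality: `|x|, |y| ≤ π` and `cos x + cos y > 1/2` force `x² + y² < (2π/3)²`
(reduce to `a = max (|x|, |y|) ≥ b = min (|x|, |y|)` by evenness of `cos`). [folklore] -/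
theorem klU_sq_add_sq_lt {x y : ℝ} (hx : |x| ≤ Real.pi) (hy : |y| ≤ Real.pi)
    (h : 1 / 2 < Real.cos x + Real.cos y) : x ^ 2 + y ^ 2 < (2 * Real.pi / 3) ^ 2 := by
  rw [← Real.cos_abs x, ← Real.cos_abs y] at h
  rw [← sq_abs x, ← sq_abs y]
  rcases le_total |y| |x| with hyx | hxy
  · exact klU_sq_add_sq_lt_of_le (abs_nonneg y) hyx hx h
  · have := klU_sq_add_sq_lt_of_le (abs_nonneg x) hxy hy (by linarith)
    linarith

/-! ### Disc containment and the stub -/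

/-- At energy `-1` the occupied momenta of the Brillouin zone lie in the disc of radius `2π/3`
(`cos p₀ + cos p₁ > 1/2` and `|pᵢ| ≤ π` give `p₀² + p₁² < (2π/3)²`). [folklore] -/
theorem klU_occupied_subset_ball :
    {p : Momentum | squareDispersion 1 0 p < -1} ∩ brillouinZone ⊆
      Metric.ball (0 : Momentum) (2 * Real.pi / 3) := by
  intro p hp
  obtain ⟨hp1, hp2⟩ := hp
  simp only [Set.mem_setOf_eq, squareDispersion] at hp1
  have hsum : 1 / 2 < Real.cos (p 0) + Real.cos (p 1) := by linarith
  have habs : ∀ i, |p i| ≤ Real.pi := fun i => by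
    have := hp2 i
    rw [abs_le]
    exact ⟨this.1, this.2.le⟩
  have key := klU_sq_add_sq_lt (habs 0) (habs 1) hsum
  rw [EuclideanSpace.ball_zero_eq _ (by positivity), Set.mem_setOf_eq, Fin.sum_univ_two]
  exact key

/-- **Stub `stub_klFillingUpper`** (E0, upper end): at `μ = -1` the free-band filling is at most
`7/10`: the Fermi sea `{cos x + cos y > 1/2}` lies in the disc of radius `2π/3`, so
`n(-1) ≤ 2 π (2π/3)² / (2π)² = 2π/9 < 7/10` (`π < 3.15`). [folklore] -/
theorem stub_klFillingUpper :
    KohnLuttinger.filling (squareDispersion 1 0) (-1) ≤ 7 / 10 := by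
  rw [kl_mu_filling_eq]
  have hV : (volume ({p : Momentum | squareDispersion 1 0 p < -1} ∩ brillouinZone)).toReal ≤
      (2 * Real.pi / 3) ^ 2 * Real.pi := by
    have h1 : volume ({p : Momentum | squareDispersion 1 0 p < -1} ∩ brillouinZone) ≤
        volume (Metric.ball (0 : Momentum) (2 * Real.pi / 3)) :=
      measure_mono klU_occupied_subset_ball
    have h2 : (volume (Metric.ball (0 : Momentum) (2 * Real.pi / 3))).toReal =
        (2 * Real.pi / 3) ^ 2 * Real.pi := by
      rw [EuclideanSpace.volume_ball_fin_two, ENNReal.toReal_mul, ENNReal.toReal_pow,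
        ENNReal.toReal_ofReal (by positivity), ENNReal.toReal_ofReal Real.pi_pos.le]
    rw [← h2]
    exact ENNReal.toReal_mono measure_ball_lt_top.ne h1
  have hpi := Real.pi_lt_d2
  have hpi0 := Real.pi_pos
  rw [div_le_iff₀ (by positivity)]
  nlinarith [mul_nonneg (sq_nonneg Real.pi) (sub_nonneg.2 hpi.le)]

end Summit.HubbardSuperconductivity.HubbardSuperconductivity.Theorems
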